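import Summits.BirchSwinnertonDyer.BirchSwinnertonDyer.Theorems.BiquadraticEisensteinDescentManinDatumSupercuspidalCMInertStubsOfModelLValues
import Summits.BirchSwinnertonDyer.BirchSwinnertonDyer.Theorems.BiquadraticEisensteinDescentManinDatumSupercuspidalCMInertResolventBoundReduction
import HarnessLib

set_option linter.dupNamespace false -- `Summit.BirchSwinnertonDyer.BirchSwinnertonDyer.Theorems.…` (summit = sub, D-0017)
set_option autoImplicit false

/-!
# Crux `ManinDatumSupercuspidalCMInert` (stmt-BirchSwinnertonDyer-20111, BED r605) from `H₅` and the resolvent bound RES₇ / RES₇fin —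
# the crux-level closers of record for the `j = 1728` cell
# (width seat `bsd-wall-cm-bed-w2` g10; theorems only; route cone (imports the Theses file through `…StubsOfModelLValues`); `--supports 20111`, helper)

Route `BiquadraticEisensteinDescent` (cell `pub/bsd-wall`). Compositions only:

* `H7_of_resolventBound` — **RES₇ ⟹ H₇** (bed-w3 g9 `H7_of_core` ∘ this seat's `core_seven_of_resolventBound`, p640345);
  `H7_of_smallEvenResolventBound` — **RES₇fin ⟹ H₇** (∘ `resolventBound_of_smallEven`, p641835).
* ★ `maninDatumSupercuspidalCMInert_of_H5_of_resolventBound` — **H₅ ∧ RES₇ ⟹ `ManinDatumSupercuspidalCMInert`** (the crux BY NAME), through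
  `maninDatumSupercuspidalCMInert_of_modelOddLValues` (p635902); ★ `maninDatumSupercuspidalCMInert_of_H5_of_smallEvenResolventBound` — **H₅ ∧ RES₇fin ⟹ crux**.

Here H₅ / H₇ are the model odd-`L`-value hypotheses of p635902 (sextic twists `y² = x³ + k`, `5 ∣ k` sixth-power-free / quartic twists
`y² = x³ + Ax`, `7 ∣ A` fourth-power-free), RES₇ is the hypothesis of `stub_S7_of_resolventBound` and RES₇fin its restriction to the 15 even exponents
`n < 6(4 − k)` (`…ResolventBoundReduction`). READING for the planner: crux 20111 = H₅ (the `j = 0` cell at `5`: no `ℤ[ω]` dictionary yet, bed-w1 g8's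
S5 road) ∧ RES₇fin (the `j = 1728` cell at `7`: 15 exact resolvent valuations, bed-w3 g10 certificate / bed-w4 g11 Galois lanes).

HONEST FRAMING: neither H₅ nor RES₇fin is proved here; nothing in this file proves the crux, Manin's conjecture or BSD. No definition, no named fact,
no `sorry`; axioms standard.
-/

noncomputable section

open scoped Classical ComplexConjugate

open Complex PeriodPair WeierstrassCurve IsDedekindDomain NumberField
open Literature.NumberTheory.EllipticCurves Literature.NumberTheory.EllipticCurves.GaussianLattice
open Literature.NumberTheory.LFunctions Literature.NumberTheory.LFunctions.GaussianTheta
open Literature.NumberTheory.QuadraticFields.GaussianQuarticSymbol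
open Literature.NumberTheory.EllipticCurves.ModularForms
open Literature.NumberTheory.EllipticCurves.Rank1Residual
open Literature.NumberTheory.DiophantineGeometry
open Summit.BirchSwinnertonDyer.BirchSwinnertonDyer.Theses.BiquadraticEisensteinDescent

namespace Summit.BirchSwinnertonDyer.BirchSwinnertonDyer.Theorems.BiquadraticEisensteinDescentManinDatumSupercuspidalCMInertOfH5OfResolventBound

open Summit.BirchSwinnertonDyer.BirchSwinnertonDyer.Theorems.BiquadraticEisensteinDescentManinDatumSupercuspidalCMInertStubsOfModelLValues
  (maninDatumSupercuspidalCMInert_of_modelOddLValues)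
open Summit.BirchSwinnertonDyer.BirchSwinnertonDyer.Theorems.BiquadraticEisensteinDescentManinDatumSupercuspidalCMInertTorsionCoreBezoutFree
  (H7_of_core)
open Summit.BirchSwinnertonDyer.BirchSwinnertonDyer.Theorems.BiquadraticEisensteinDescentManinDatumSupercuspidalCMInertStubS7OfResolventBound
  (core_seven_of_resolventBound)
open Summit.BirchSwinnertonDyer.BirchSwinnertonDyer.Theorems.BiquadraticEisensteinDescentManinDatumSupercuspidalCMInertResolventBoundReduction
  (resolventBound_of_smallEven)

/-- **RES₇ ⟹ H₇**: the model odd-`L`-value integrality for the quartic twists `y² = x³ + Ax` (`7 ∣ A` fourth-power-free) at every admissible odd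
character follows from the resolvent bound, through Core₇ (`core_seven_of_resolventBound`) and bed-w3 g9's `H7_of_core`. [cite: Rubin1999, Prop. 7.15]
[cite: Serre1979, Ch. IV §2 Prop. 7] -/
theorem H7_of_resolventBound
    (hRES : ∀ k : ℕ, 1 ≤ k → k ≤ 3 → ∀ n : ℕ, 1 ≤ n →
      ∀ (Γ₀ : Type) [LinearOrderedCommGroupWithZero Γ₀] (v : Valuation ℂ Γ₀), v 7 < 1 →
        v (∑ b : ZMod 7 × ZMod 7, (conj (((quarticCharMod 7 (rep 7 b 0) : GaussianInt) : ℂ))) ^ k *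
          (℘[ofUpperHalfPlane UpperHalfPlane.I] (conj ((rep 7 b 0 : GaussianInt) : ℂ) / 7) /
            ((Real.Gamma (1 / 4) ^ 2 / (2 * Real.sqrt (2 * Real.pi)) : ℝ) : ℂ) ^ 2)⁻¹ ^ n) ^ 4 ≤ v 7 ^ (4 - k)) :
    ∀ (A : ℤ), A ≠ 0 → (7 : ℤ) ∣ A → (∀ q : ℕ, q.Prime → ¬ ((q : ℤ) ^ 4 ∣ A)) →
      ∀ (ℓ : ℕ) [NeZero ℓ], ℓ.Prime → ℓ ≠ 2 → ¬ (ℓ : ℤ) ∣ A → ¬ 4 ∣ ℓ - 1 → ¬ 7 ∣ ℓ - 1 → ¬ 3 ∣ ℓ - 1 →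
        IsSquare ((7 : ℕ) : ZMod ℓ) →
      ∀ χ : DirichletCharacter ℂ ℓ, χ.Odd →
      ∃ L : ℂ → ℂ, Differentiable ℂ L ∧
        (∀ s : ℂ, 2 < s.re → L s = LSeries (fun n : ℕ ↦ χ⁻¹ (n : ZMod ℓ) *
          ((⟨0, 0, 0, (A : ℚ), 0⟩ : WeierstrassCurve ℚ).LFunction n : ℂ)) s) ∧
        ∃ s : ℕ, ¬ 7 ∣ s ∧ IsIntegral ℤ ((s : ℂ) * (gaussSum χ (ZMod.stdAddChar (N := ℓ)) * L 1 /
          (Complex.I * ((⟨0, 0, 0, (A : ℚ), 0⟩ : WeierstrassCurve ℚ).imaginaryPeriodRat : ℂ)))) :=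
  H7_of_core (core_seven_of_resolventBound hRES)

/-- **RES₇fin ⟹ H₇** (only the 15 even small resolvents). [cite: Rubin1999, Prop. 7.15] -/
theorem H7_of_smallEvenResolventBound
    (h : ∀ k : ℕ, 1 ≤ k → k ≤ 3 → ∀ n : ℕ, 1 ≤ n → Even n → n < 6 * (4 - k) →
      ∀ (Γ₀ : Type) [LinearOrderedCommGroupWithZero Γ₀] (v : Valuation ℂ Γ₀), v 7 < 1 →
        v (∑ b : ZMod 7 × ZMod 7, (conj (((quarticCharMod 7 (rep 7 b 0) : GaussianInt) : ℂ))) ^ k *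
          (℘[ofUpperHalfPlane UpperHalfPlane.I] (conj ((rep 7 b 0 : GaussianInt) : ℂ) / 7) /
            ((Real.Gamma (1 / 4) ^ 2 / (2 * Real.sqrt (2 * Real.pi)) : ℝ) : ℂ) ^ 2)⁻¹ ^ n) ^ 4 ≤ v 7 ^ (4 - k)) :
    ∀ (A : ℤ), A ≠ 0 → (7 : ℤ) ∣ A → (∀ q : ℕ, q.Prime → ¬ ((q : ℤ) ^ 4 ∣ A)) →
      ∀ (ℓ : ℕ) [NeZero ℓ], ℓ.Prime → ℓ ≠ 2 → ¬ (ℓ : ℤ) ∣ A → ¬ 4 ∣ ℓ - 1 → ¬ 7 ∣ ℓ - 1 → ¬ 3 ∣ ℓ - 1 →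
        IsSquare ((7 : ℕ) : ZMod ℓ) →
      ∀ χ : DirichletCharacter ℂ ℓ, χ.Odd →
      ∃ L : ℂ → ℂ, Differentiable ℂ L ∧
        (∀ s : ℂ, 2 < s.re → L s = LSeries (fun n : ℕ ↦ χ⁻¹ (n : ZMod ℓ) *
          ((⟨0, 0, 0, (A : ℚ), 0⟩ : WeierstrassCurve ℚ).LFunction n : ℂ)) s) ∧
        ∃ s : ℕ, ¬ 7 ∣ s ∧ IsIntegral ℤ ((s : ℂ) * (gaussSum χ (ZMod.stdAddChar (N := ℓ)) * L 1 /
          (Complex.I * ((⟨0, 0, 0, (A : ℚ), 0⟩ : WeierstrassCurve ℚ).imaginaryPeriodRat : ℂ)))) :=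
  H7_of_resolventBound (resolventBound_of_smallEven h)

/-- ★ **H₅ ∧ RES₇ ⟹ `ManinDatumSupercuspidalCMInert`** (the crux BY NAME): the `j = 0` cell from the model odd-`L`-value hypothesis H₅ (p635902) and
the `j = 1728` cell from the resolvent bound RES₇ (this file's `H7_of_resolventBound`). [cite: Manin1972, Thm. 1.6] [cite: Edixhoven1991, Thm. 3] -/
theorem maninDatumSupercuspidalCMInert_of_H5_of_resolventBound
    (H₅ : ∀ (k : ℤ), k ≠ 0 → (5 : ℤ) ∣ k → (∀ q : ℕ, q.Prime → ¬ ((q : ℤ) ^ 6 ∣ k)) →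
      ∀ (ℓ : ℕ) [NeZero ℓ], ℓ.Prime → 5 ≤ ℓ → ¬ (ℓ : ℤ) ∣ k → ¬ 4 ∣ ℓ - 1 → ¬ 5 ∣ ℓ - 1 →
        IsSquare ((5 : ℕ) : ZMod ℓ) →
      ∀ χ : DirichletCharacter ℂ ℓ, χ.Odd →
      ∃ L : ℂ → ℂ, Differentiable ℂ L ∧
        (∀ s : ℂ, 2 < s.re → L s = LSeries (fun n : ℕ ↦ χ⁻¹ (n : ZMod ℓ) *
          ((⟨0, 0, 0, 0, (k : ℚ)⟩ : WeierstrassCurve ℚ).LFunction n : ℂ)) s) ∧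
        ∃ s : ℕ, ¬ 5 ∣ s ∧ IsIntegral ℤ ((s : ℂ) * (gaussSum χ (ZMod.stdAddChar (N := ℓ)) * L 1 /
          (Complex.I * ((⟨0, 0, 0, 0, (k : ℚ)⟩ : WeierstrassCurve ℚ).imaginaryPeriodRat : ℂ)))))
    (hRES : ∀ k : ℕ, 1 ≤ k → k ≤ 3 → ∀ n : ℕ, 1 ≤ n →
      ∀ (Γ₀ : Type) [LinearOrderedCommGroupWithZero Γ₀] (v : Valuation ℂ Γ₀), v 7 < 1 →
        v (∑ b : ZMod 7 × ZMod 7, (conj (((quarticCharMod 7 (rep 7 b 0) : GaussianInt) : ℂ))) ^ k *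
          (℘[ofUpperHalfPlane UpperHalfPlane.I] (conj ((rep 7 b 0 : GaussianInt) : ℂ) / 7) /
            ((Real.Gamma (1 / 4) ^ 2 / (2 * Real.sqrt (2 * Real.pi)) : ℝ) : ℂ) ^ 2)⁻¹ ^ n) ^ 4 ≤ v 7 ^ (4 - k)) :
    ManinDatumSupercuspidalCMInert :=
  maninDatumSupercuspidalCMInert_of_modelOddLValues H₅ (H7_of_resolventBound hRES)

/-- ★ **H₅ ∧ RES₇fin ⟹ `ManinDatumSupercuspidalCMInert`** (the crux BY NAME, with the resolvent bound demanded only for the 15 even exponents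
`n < 6(4 − k)`). [cite: Manin1972, Thm. 1.6] [cite: Edixhoven1991, Thm. 3] -/
theorem maninDatumSupercuspidalCMInert_of_H5_of_smallEvenResolventBound
    (H₅ : ∀ (k : ℤ), k ≠ 0 → (5 : ℤ) ∣ k → (∀ q : ℕ, q.Prime → ¬ ((q : ℤ) ^ 6 ∣ k)) →
      ∀ (ℓ : ℕ) [NeZero ℓ], ℓ.Prime → 5 ≤ ℓ → ¬ (ℓ : ℤ) ∣ k → ¬ 4 ∣ ℓ - 1 → ¬ 5 ∣ ℓ - 1 →
        IsSquare ((5 : ℕ) : ZMod ℓ) →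
      ∀ χ : DirichletCharacter ℂ ℓ, χ.Odd →
      ∃ L : ℂ → ℂ, Differentiable ℂ L ∧
        (∀ s : ℂ, 2 < s.re → L s = LSeries (fun n : ℕ ↦ χ⁻¹ (n : ZMod ℓ) *
          ((⟨0, 0, 0, 0, (k : ℚ)⟩ : WeierstrassCurve ℚ).LFunction n : ℂ)) s) ∧
        ∃ s : ℕ, ¬ 5 ∣ s ∧ IsIntegral ℤ ((s : ℂ) * (gaussSum χ (ZMod.stdAddChar (N := ℓ)) * L 1 /
          (Complex.I * ((⟨0, 0, 0, 0, (k : ℚ)⟩ : WeierstrassCurve ℚ).imaginaryPeriodRat : ℂ)))))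
    (h : ∀ k : ℕ, 1 ≤ k → k ≤ 3 → ∀ n : ℕ, 1 ≤ n → Even n → n < 6 * (4 - k) →
      ∀ (Γ₀ : Type) [LinearOrderedCommGroupWithZero Γ₀] (v : Valuation ℂ Γ₀), v 7 < 1 →
        v (∑ b : ZMod 7 × ZMod 7, (conj (((quarticCharMod 7 (rep 7 b 0) : GaussianInt) : ℂ))) ^ k *
          (℘[ofUpperHalfPlane UpperHalfPlane.I] (conj ((rep 7 b 0 : GaussianInt) : ℂ) / 7) /
            ((Real.Gamma (1 / 4) ^ 2 / (2 * Real.sqrt (2 * Real.pi)) : ℝ) : ℂ) ^ 2)⁻¹ ^ n) ^ 4 ≤ v 7 ^ (4 - k)) :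
    ManinDatumSupercuspidalCMInert :=
  maninDatumSupercuspidalCMInert_of_H5_of_resolventBound H₅ (resolventBound_of_smallEven h)

end Summit.BirchSwinnertonDyer.BirchSwinnertonDyer.Theorems.BiquadraticEisensteinDescentManinDatumSupercuspidalCMInertOfH5OfResolventBound

end
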